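import Mathlib
import HarnessLib
import Literature.Analysis.FluidPDE.SpaceTimeCalculus
import Summits.NavierStokesRegularity.NavierStokesRegularity.Theorems.PoloidalWindowDoorPoloidalWindowRigidityZShockLocalEnergy

/-!
# Crux K2 `PoloidalWindowRigidity` (stmt-NavierStokesRegularity-19708), line `z_shock` — R3 infrastructure, part 3: the LOCAL ENERGY
# INEQUALITY FOR THE QUASILINEAR WAVE EQUATION `w_ss = div(γ(w)∇w)` itself (the autonomous height-evolution, height as time, in `ℝⁿ`)

`--supports stmt-NavierStokesRegularity-19708 --as helper` (leafhand-ns-poloidalwindowdoor-3 g5, cell decomp-ns, 2026-08-31).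
**No stub and no summit is closed by this file; Navier–Stokes regularity is NOT proved here (rung 0).**

WHY THIS FILE.  Rung R3 of `Cruxes/PoloidalWindowRigidity/Lines/z_shock.md` (§Hardest stub) is a statement about two-sided bounded smooth
solutions `w : ℝ_s × ℝ² → ℝ` of the autonomous height-evolution `w_ss = divₕ(c²(w)∇ₕw)` (`c² = −G' > 0`; `s` = the height `z`).  Parts 1–2
(`…ZShockLocalEnergyCutoff`, `…ZShockLocalEnergy`) give the abstract local energy inequality for any balance law `∂ₛe + div f = σ` with
dominated flux.  This file instantiates it ON THE EQUATION, in its natural `(s, y)` typing and in every dimension `n`: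

* `waveEnergy_balance`: for jointly smooth `w` solving `∂ₛ∂ₛw = Σᵢ ∂ᵢ(γ(w) ∂ᵢw)` (`γ` smooth), the energy `e = ½(∂ₛw)² + ½γ(w)|∇w|²`, flux
  `fᵢ = −γ(w) ∂ₛw ∂ᵢw` and source `σ = ½γ'(w) ∂ₛw |∇w|²` satisfy the balance law `∂ₛe + Σᵢ ∂ᵢfᵢ = σ` pointwise (product rule + Schwarz
  `∂ₛ∂ᵢw = ∂ᵢ∂ₛw`, the tree's `IsSmoothSpaceTimeOn.hasDerivAt_fderiv_slice`) — the `(s, y)`-typed twin of 3-g4's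
  `…ZShockWaveEnergy.waveEnergy_identity_of_slope_function`;
* `waveEnergy_flux_dominated`: if `0 ≤ γ(w) ≤ c²` then `0 ≤ c⟨y⟩e + Σᵢ yᵢfᵢ` (Cauchy–Schwarz + AM–GM: `|γ wₛ ∂_y w| ≤ √γ·e·|y|`);
* `waveEnergy_source_le`: if `|γ'(w) ∂ₛw| ≤ K γ(w)` then `σ ≤ K e`;
* `waveEnergy_closedBall_le_exp_mul`: hence, for such a solution on the heights `s ≥ t₀`, the wave energy in the ball `|y| ≤ ρ` at height
  `t ≥ t₀` is at most `exp(K(t − t₀))` times the wave energy at height `t₀` in the ball `|y| ≤ √(1+ρ²) + c(t − t₀) + 1`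
  (part 2's `setIntegral_closedBall_le_exp_mul`);
* `static_of_static_data`: DOMAIN OF DEPENDENCE proper — if the data at height `t₀` are static (`∂ₛw = 0`, `∇w = 0`) on that larger ball, the
  solution is static (`∂ₛw = 0`, `γ(w)|∇w|² = 0`) on the open ball `|y| < ρ` at height `t` (a continuous nonnegative density with zero
  integral vanishes: `eq_zero_of_setIntegral_closedBall_eq_zero`).

READING (honest).  On the data of R3 — `w` bounded with bounded first derivatives, `γ = c²` bounded between positive constants with bounded
`γ'` on the range — the hypotheses hold on every height half-line with `K = sup|γ'|·sup|∂ₛw| / inf γ`, in both height directions (apply to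
`s ↦ w(−s)`), so the wave energy of an eternal solution is controlled locally-uniformly along backward and forward acoustic cones.  This is
the integrated entrance of any energy / almost-conservation argument for R3; it proves no rigidity (the cubic source is exactly the THICK
term, `γ' = 0` iff (TH)).  presearch: textbook (Evans PDE §2.4.3; [corpus:book:alinhac2009 pp.44–46]); not previously in the tree for a
quasilinear equation. [folklore]
-/

noncomputable section

namespace Summit.NavierStokesRegularity.NavierStokesRegularity.Theorems.PoloidalWindowDoorPoloidalWindowRigidityZShockWaveLocalEnergy

-- the problem directory repeats the summit name (`NavierStokesRegularity/NavierStokesRegularity`)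
set_option linter.dupNamespace false

open MeasureTheory Set Filter Topology Function Metric
open scoped ContDiff
open Literature.Analysis.FluidPDE
open Summit.NavierStokesRegularity.NavierStokesRegularity.Theorems.PoloidalWindowDoorPoloidalWindowRigidityZShockLocalEnergyCutoff
open Summit.NavierStokesRegularity.NavierStokesRegularity.Theorems.PoloidalWindowDoorPoloidalWindowRigidityZShockLocalEnergy

variable {n : ℕ} {w : ℝ → EuclideanSpace ℝ (Fin n) → ℝ} {γ : ℝ → ℝ}

/-! ### Smoothness bookkeeping -/

/-- A globally jointly smooth field is a smooth space–time field on the whole height axis. [folklore] -/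
theorem isSmoothSpaceTimeOn_univ (hw : ContDiff ℝ ∞ (uncurry w)) : IsSmoothSpaceTimeOn univ w := hw.contDiffOn

/-- Conversely, a smooth space–time field on the whole height axis is globally jointly smooth. [folklore] -/
theorem contDiff_uncurry_of_isSmoothSpaceTimeOn_univ {v : ℝ → EuclideanSpace ℝ (Fin n) → ℝ}
    (hv : IsSmoothSpaceTimeOn univ v) : ContDiff ℝ ∞ (uncurry v) := by
  rwa [IsSmoothSpaceTimeOn, univ_prod_univ, contDiffOn_univ] at hv

/-- The height derivative `∂ₛw` of a globally smooth field is globally smooth. [folklore] -/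
theorem contDiff_uncurry_deriv (hw : ContDiff ℝ ∞ (uncurry w)) :
    ContDiff ℝ ∞ (uncurry fun s y => deriv (fun s' => w s' y) s) :=
  contDiff_uncurry_of_isSmoothSpaceTimeOn_univ ((isSmoothSpaceTimeOn_univ hw).isSmoothSpaceTimeOn_deriv isOpen_univ)

/-- The spatial partial derivative `∂ₐw` of a globally smooth field is globally smooth. [folklore] -/
theorem contDiff_uncurry_fderiv_apply (hw : ContDiff ℝ ∞ (uncurry w)) (a : EuclideanSpace ℝ (Fin n)) :
    ContDiff ℝ ∞ (uncurry fun s y => fderiv ℝ (w s) y a) :=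
  contDiff_uncurry_of_isSmoothSpaceTimeOn_univ
    ((isSmoothSpaceTimeOn_univ hw).isSmoothSpaceTimeOn_fderiv_apply isOpen_univ a)

/-- `γ ∘ w` is globally smooth. [folklore] -/
theorem contDiff_uncurry_comp (hw : ContDiff ℝ ∞ (uncurry w)) (hγ : ContDiff ℝ ∞ γ) :
    ContDiff ℝ ∞ (uncurry fun s y => γ (w s y)) := hγ.comp hw

/-- The wave energy density `e = ½(∂ₛw)² + ½γ(w)Σᵢ(∂ᵢw)²` is globally smooth. [folklore] -/
theorem contDiff_uncurry_energy (hw : ContDiff ℝ ∞ (uncurry w)) (hγ : ContDiff ℝ ∞ γ) :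
    ContDiff ℝ ∞ (uncurry fun s y => (1 / 2) * deriv (fun s' => w s' y) s ^ 2 +
      (1 / 2) * γ (w s y) * ∑ i, fderiv ℝ (w s) y (EuclideanSpace.single i 1) ^ 2) := by
  have h1 := contDiff_uncurry_deriv hw
  have h2 := contDiff_uncurry_comp hw hγ
  have h3 : ContDiff ℝ ∞ fun p : ℝ × EuclideanSpace ℝ (Fin n) =>
      ∑ i, fderiv ℝ (w p.1) p.2 (EuclideanSpace.single i 1) ^ 2 :=
    ContDiff.sum fun i _ => (contDiff_uncurry_fderiv_apply hw (EuclideanSpace.single i 1)).pow 2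
  exact (contDiff_const.mul (h1.pow 2)).add ((contDiff_const.mul h2).mul h3)

/-- The wave energy flux component `fᵢ = −γ(w) ∂ₛw ∂ᵢw` is globally smooth. [folklore] -/
theorem contDiff_uncurry_flux (hw : ContDiff ℝ ∞ (uncurry w)) (hγ : ContDiff ℝ ∞ γ) (i : Fin n) :
    ContDiff ℝ ∞ (uncurry fun s y => -(γ (w s y) * deriv (fun s' => w s' y) s *
      fderiv ℝ (w s) y (EuclideanSpace.single i 1))) :=
  (((contDiff_uncurry_comp hw hγ).mul (contDiff_uncurry_deriv hw)).mul
    (contDiff_uncurry_fderiv_apply hw (EuclideanSpace.single i 1))).neg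

/-- The wave energy source `σ = ½γ'(w) ∂ₛw Σᵢ(∂ᵢw)²` is globally smooth. [folklore] -/
theorem contDiff_uncurry_source (hw : ContDiff ℝ ∞ (uncurry w)) (hγ : ContDiff ℝ ∞ γ) :
    ContDiff ℝ ∞ (uncurry fun s y => (1 / 2) * deriv γ (w s y) * deriv (fun s' => w s' y) s *
      ∑ i, fderiv ℝ (w s) y (EuclideanSpace.single i 1) ^ 2) := by
  have h1 := contDiff_uncurry_deriv hw
  have hγ' : ContDiff ℝ ∞ (deriv γ) := by simpa using hγ.iterate_deriv 1
  have h2 : ContDiff ℝ ∞ (uncurry fun s y => deriv γ (w s y)) := hγ'.comp hw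
  have h3 : ContDiff ℝ ∞ fun p : ℝ × EuclideanSpace ℝ (Fin n) =>
      ∑ i, fderiv ℝ (w p.1) p.2 (EuclideanSpace.single i 1) ^ 2 :=
    ContDiff.sum fun i _ => (contDiff_uncurry_fderiv_apply hw (EuclideanSpace.single i 1)).pow 2
  exact ((contDiff_const.mul h2).mul h1).mul h3

/-! ### The balance law of the wave energy -/

/-- **The wave-energy balance law for `w_ss = div(γ(w)∇w)`.**  For jointly smooth `w : ℝ × ℝⁿ → ℝ` solving
`∂ₛ∂ₛw = Σᵢ ∂ᵢ(γ(w) ∂ᵢw)` with `γ` smooth: `∂ₛ[½(∂ₛw)² + ½γ(w)|∇w|²] + Σᵢ ∂ᵢ[−γ(w) ∂ₛw ∂ᵢw] = ½γ'(w) ∂ₛw |∇w|²`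
(product rule; the mixed terms cancel by Schwarz `∂ₛ∂ᵢw = ∂ᵢ∂ₛw`). [folklore] -/
theorem waveEnergy_balance (hw : ContDiff ℝ ∞ (uncurry w)) (hγ : ContDiff ℝ ∞ γ)
    (hpde : ∀ s y, deriv (fun s' => deriv (fun s'' => w s'' y) s') s =
      ∑ i, fderiv ℝ (fun y' => γ (w s y') * fderiv ℝ (w s) y' (EuclideanSpace.single i 1)) y
        (EuclideanSpace.single i 1))
    (s : ℝ) (y : EuclideanSpace ℝ (Fin n)) :
    deriv (fun s' => (1 / 2) * deriv (fun s'' => w s'' y) s' ^ 2 +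
        (1 / 2) * γ (w s' y) * ∑ i, fderiv ℝ (w s') y (EuclideanSpace.single i 1) ^ 2) s +
      ∑ i, fderiv ℝ (fun y' => -(γ (w s y') * deriv (fun s'' => w s'' y') s *
          fderiv ℝ (w s) y' (EuclideanSpace.single i 1))) y (EuclideanSpace.single i 1) =
      (1 / 2) * deriv γ (w s y) * deriv (fun s'' => w s'' y) s *
        ∑ i, fderiv ℝ (w s) y (EuclideanSpace.single i 1) ^ 2 := by
  have hST : IsSmoothSpaceTimeOn univ w := isSmoothSpaceTimeOn_univ hw
  -- the fields `∂ₛw`, `∂ᵢw` and their smoothness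
  have hds : ContDiff ℝ ∞ (uncurry fun s y => deriv (fun s' => w s' y) s) := contDiff_uncurry_deriv hw
  have hdi : ∀ i : Fin n, ContDiff ℝ ∞ (uncurry fun s y => fderiv ℝ (w s) y (EuclideanSpace.single i 1)) :=
    fun i => contDiff_uncurry_fderiv_apply hw _
  have hγd : Differentiable ℝ γ := hγ.differentiable (by simp)
  -- height derivatives at `s` (fixed `y`)
  have hl0 : HasDerivAt (fun s' => w s' y) (deriv (fun s'' => w s'' y) s) s :=
    ((contDiff_line hw y).differentiable (by simp) s).hasDerivAt
  have hl1 : HasDerivAt (fun s' => deriv (fun s'' => w s'' y) s')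
      (deriv (fun s' => deriv (fun s'' => w s'' y) s') s) s :=
    ((contDiff_line hds y).differentiable (by simp) s).hasDerivAt
  have hl2 : ∀ i : Fin n, HasDerivAt (fun s' => fderiv ℝ (w s') y (EuclideanSpace.single i 1))
      (fderiv ℝ (fun y' => deriv (fun s'' => w s'' y') s) y (EuclideanSpace.single i 1)) s :=
    fun i => hST.hasDerivAt_fderiv_slice isOpen_univ (mem_univ s) y (EuclideanSpace.single i 1)
  have hl3 : HasDerivAt (fun s' => γ (w s' y)) (deriv γ (w s y) * deriv (fun s'' => w s'' y) s) s :=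
    (hγd (w s y)).hasDerivAt.comp s hl0
  -- the height derivative of the energy
  have hE : HasDerivAt (fun s' => (1 / 2) * deriv (fun s'' => w s'' y) s' ^ 2 +
        (1 / 2) * γ (w s' y) * ∑ i, fderiv ℝ (w s') y (EuclideanSpace.single i 1) ^ 2)
      ((1 / 2) * (2 * deriv (fun s'' => w s'' y) s * deriv (fun s' => deriv (fun s'' => w s'' y) s') s) +
        ((1 / 2) * (deriv γ (w s y) * deriv (fun s'' => w s'' y) s) *
            ∑ i, fderiv ℝ (w s) y (EuclideanSpace.single i 1) ^ 2 +
          (1 / 2) * γ (w s y) * ∑ i, 2 * fderiv ℝ (w s) y (EuclideanSpace.single i 1) *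
            fderiv ℝ (fun y' => deriv (fun s'' => w s'' y') s) y (EuclideanSpace.single i 1))) s := by
    have hsq : HasDerivAt (fun s' => deriv (fun s'' => w s'' y) s' ^ 2)
        (2 * deriv (fun s'' => w s'' y) s * deriv (fun s' => deriv (fun s'' => w s'' y) s') s) s := by
      have := hl1.fun_pow 2
      simpa using this
    have hsum : HasDerivAt (fun s' => ∑ i, fderiv ℝ (w s') y (EuclideanSpace.single i 1) ^ 2)
        (∑ i, 2 * fderiv ℝ (w s) y (EuclideanSpace.single i 1) *
          fderiv ℝ (fun y' => deriv (fun s'' => w s'' y') s) y (EuclideanSpace.single i 1)) s := by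
      have := HasDerivAt.fun_sum (u := Finset.univ) fun i _ => (hl2 i).fun_pow 2
      simpa using this
    exact (hsq.const_mul (1 / 2)).fun_add ((hl3.const_mul (1 / 2)).fun_mul hsum)
  -- spatial derivatives at `y` (fixed `s`)
  have hws : ContDiff ℝ ∞ (w s) := contDiff_slice hw s
  have hdss : ContDiff ℝ ∞ fun y' => deriv (fun s'' => w s'' y') s := contDiff_slice hds s
  have hdis : ∀ i : Fin n, ContDiff ℝ ∞ fun y' => fderiv ℝ (w s) y' (EuclideanSpace.single i 1) :=
    fun i => contDiff_slice (hdi i) s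
  have hm0 : HasFDerivAt (w s) (fderiv ℝ (w s) y) y := (hws.differentiable (by simp) y).hasFDerivAt
  have hm1 : HasFDerivAt (fun y' => γ (w s y')) (deriv γ (w s y) • fderiv ℝ (w s) y) y :=
    (hγd (w s y)).hasDerivAt.comp_hasFDerivAt y hm0
  have hm2 : HasFDerivAt (fun y' => deriv (fun s'' => w s'' y') s)
      (fderiv ℝ (fun y' => deriv (fun s'' => w s'' y') s) y) y := (hdss.differentiable (by simp) y).hasFDerivAt
  have hm3 : ∀ i : Fin n, HasFDerivAt (fun y' => fderiv ℝ (w s) y' (EuclideanSpace.single i 1))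
      (fderiv ℝ (fun y' => fderiv ℝ (w s) y' (EuclideanSpace.single i 1)) y) y :=
    fun i => ((hdis i).differentiable (by simp) y).hasFDerivAt
  -- the divergence-form PDE, expanded
  have hP : ∀ i : Fin n, fderiv ℝ (fun y' => γ (w s y') * fderiv ℝ (w s) y' (EuclideanSpace.single i 1)) y
      (EuclideanSpace.single i 1) =
      deriv γ (w s y) * fderiv ℝ (w s) y (EuclideanSpace.single i 1) *
          fderiv ℝ (w s) y (EuclideanSpace.single i 1) +
        γ (w s y) * fderiv ℝ (fun y' => fderiv ℝ (w s) y' (EuclideanSpace.single i 1)) y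
          (EuclideanSpace.single i 1) := by
    intro i
    rw [(hm1.fun_mul (hm3 i)).fderiv]
    simp only [_root_.add_apply, _root_.smul_apply, smul_eq_mul]
    ring
  -- the flux divergence, expanded
  have hF : ∀ i : Fin n, fderiv ℝ (fun y' => -(γ (w s y') * deriv (fun s'' => w s'' y') s *
      fderiv ℝ (w s) y' (EuclideanSpace.single i 1))) y (EuclideanSpace.single i 1) =
      -((deriv γ (w s y) * fderiv ℝ (w s) y (EuclideanSpace.single i 1) * deriv (fun s'' => w s'' y) s +
          γ (w s y) * fderiv ℝ (fun y' => deriv (fun s'' => w s'' y') s) y (EuclideanSpace.single i 1)) *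
          fderiv ℝ (w s) y (EuclideanSpace.single i 1) +
        γ (w s y) * deriv (fun s'' => w s'' y) s *
          fderiv ℝ (fun y' => fderiv ℝ (w s) y' (EuclideanSpace.single i 1)) y (EuclideanSpace.single i 1)) := by
    intro i
    rw [((hm1.fun_mul hm2).fun_mul (hm3 i)).fun_neg.fderiv]
    simp only [_root_.neg_apply, _root_.add_apply, _root_.smul_apply, smul_eq_mul]
    ring
  -- assemble: every `i`-th summand cancels
  rw [hE.deriv, Finset.sum_congr rfl fun i _ => hF i, hpde s y, Finset.sum_congr rfl fun i _ => hP i]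
  have hsum : ∑ i : Fin n, (deriv (fun s'' => w s'' y) s *
          (deriv γ (w s y) * fderiv ℝ (w s) y (EuclideanSpace.single i 1) *
              fderiv ℝ (w s) y (EuclideanSpace.single i 1) +
            γ (w s y) * fderiv ℝ (fun y' => fderiv ℝ (w s) y' (EuclideanSpace.single i 1)) y
              (EuclideanSpace.single i 1)) +
        (1 / 2) * γ (w s y) * (2 * fderiv ℝ (w s) y (EuclideanSpace.single i 1) *
            fderiv ℝ (fun y' => deriv (fun s'' => w s'' y') s) y (EuclideanSpace.single i 1)) +
        -((deriv γ (w s y) * fderiv ℝ (w s) y (EuclideanSpace.single i 1) * deriv (fun s'' => w s'' y) s +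
            γ (w s y) * fderiv ℝ (fun y' => deriv (fun s'' => w s'' y') s) y (EuclideanSpace.single i 1)) *
            fderiv ℝ (w s) y (EuclideanSpace.single i 1) +
          γ (w s y) * deriv (fun s'' => w s'' y) s *
            fderiv ℝ (fun y' => fderiv ℝ (w s) y' (EuclideanSpace.single i 1)) y (EuclideanSpace.single i 1))) =
        0 := Finset.sum_eq_zero fun i _ => by ring
  rw [Finset.sum_add_distrib, Finset.sum_add_distrib, ← Finset.mul_sum, ← Finset.mul_sum] at hsum
  linear_combination hsum

/-! ### Flux dominance and source control -/

/-- The real-arithmetic core of flux dominance: from `0 ≤ g ≤ c²`, Cauchy–Schwarz `P² ≤ N²A` and `0 ≤ N ≤ b`,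
`g u P ≤ c b (½u² + ½gA)` (AM–GM `gu²A ≤ (½u² + ½gA)²`). [folklore] -/
theorem flux_dominated_aux {g u P A N b c : ℝ} (hg0 : 0 ≤ g) (hgc : g ≤ c ^ 2) (hc : 0 ≤ c) (hA0 : 0 ≤ A)
    (hCS : P ^ 2 ≤ N ^ 2 * A) (hN : 0 ≤ N) (hNb : N ≤ b) :
    g * u * P ≤ c * b * ((1 / 2) * u ^ 2 + (1 / 2) * g * A) := by
  have hb : 0 ≤ b := hN.trans hNb
  have hNb2 : N ^ 2 ≤ b ^ 2 := by nlinarith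
  have he0 : 0 ≤ (1 / 2) * u ^ 2 + (1 / 2) * g * A := by nlinarith [sq_nonneg u, mul_nonneg hg0 hA0]
  have hR0 : 0 ≤ c * b * ((1 / 2) * u ^ 2 + (1 / 2) * g * A) := by positivity
  have h1 : (g * u * P) ^ 2 ≤ g ^ 2 * u ^ 2 * (N ^ 2 * A) := by
    have : (g * u * P) ^ 2 = g ^ 2 * u ^ 2 * P ^ 2 := by ring
    rw [this]
    exact mul_le_mul_of_nonneg_left hCS (by positivity)
  have h2 : g ^ 2 * u ^ 2 * (N ^ 2 * A) ≤ g ^ 2 * u ^ 2 * (b ^ 2 * A) :=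
    mul_le_mul_of_nonneg_left (mul_le_mul_of_nonneg_right hNb2 hA0) (by positivity)
  have h3 : g ^ 2 * u ^ 2 * (b ^ 2 * A) ≤ c ^ 2 * u ^ 2 * (b ^ 2 * A) * g := by
    have := mul_le_mul_of_nonneg_right hgc (by positivity : (0 : ℝ) ≤ u ^ 2 * (b ^ 2 * A) * g)
    calc g ^ 2 * u ^ 2 * (b ^ 2 * A) = g * (u ^ 2 * (b ^ 2 * A) * g) := by ring
      _ ≤ c ^ 2 * (u ^ 2 * (b ^ 2 * A) * g) := this
      _ = c ^ 2 * u ^ 2 * (b ^ 2 * A) * g := by ring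
  have h4 : A * (g * u ^ 2) ≤ ((1 / 2) * u ^ 2 + (1 / 2) * g * A) ^ 2 := by
    nlinarith [sq_nonneg (u ^ 2 - g * A)]
  have h5 : c ^ 2 * u ^ 2 * (b ^ 2 * A) * g ≤ (c * b * ((1 / 2) * u ^ 2 + (1 / 2) * g * A)) ^ 2 := by
    have := mul_le_mul_of_nonneg_left h4 (by positivity : (0 : ℝ) ≤ c ^ 2 * b ^ 2)
    calc c ^ 2 * u ^ 2 * (b ^ 2 * A) * g = c ^ 2 * b ^ 2 * (A * (g * u ^ 2)) := by ring
      _ ≤ c ^ 2 * b ^ 2 * ((1 / 2) * u ^ 2 + (1 / 2) * g * A) ^ 2 := this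
      _ = (c * b * ((1 / 2) * u ^ 2 + (1 / 2) * g * A)) ^ 2 := by ring
  have hsq : (g * u * P) ^ 2 ≤ (c * b * ((1 / 2) * u ^ 2 + (1 / 2) * g * A)) ^ 2 :=
    h1.trans (h2.trans (h3.trans h5))
  exact (abs_le_of_sq_le_sq' hsq hR0).2

/-- **Flux dominance for the wave energy.**  If `0 ≤ γ(w(s,y)) ≤ c²` (`c ≥ 0`), then at `(s, y)`
`0 ≤ c⟨y⟩·e + Σᵢ yᵢ fᵢ`, i.e. `|Σᵢ yᵢ γ ∂ₛw ∂ᵢw| ≤ c⟨y⟩ (½(∂ₛw)² + ½γ|∇w|²)` (Cauchy–Schwarz in `ℝⁿ`, AM–GM, `|y| ≤ ⟨y⟩`). [folklore] -/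
theorem waveEnergy_flux_dominated {c : ℝ} (hc : 0 ≤ c) (s : ℝ) (y : EuclideanSpace ℝ (Fin n))
    (hγ0 : 0 ≤ γ (w s y)) (hγc : γ (w s y) ≤ c ^ 2) :
    0 ≤ c * √(1 + ‖y‖ ^ 2) * ((1 / 2) * deriv (fun s'' => w s'' y) s ^ 2 +
        (1 / 2) * γ (w s y) * ∑ i, fderiv ℝ (w s) y (EuclideanSpace.single i 1) ^ 2) +
      ∑ i, y i * -(γ (w s y) * deriv (fun s'' => w s'' y) s * fderiv ℝ (w s) y (EuclideanSpace.single i 1)) := by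
  -- the flux sum is `−γ ∂ₛw · Σᵢ yᵢ ∂ᵢw`
  have hflux : ∑ i, y i * -(γ (w s y) * deriv (fun s'' => w s'' y) s * fderiv ℝ (w s) y (EuclideanSpace.single i 1)) =
      -(γ (w s y) * deriv (fun s'' => w s'' y) s * ∑ i, y i * fderiv ℝ (w s) y (EuclideanSpace.single i 1)) := by
    rw [Finset.mul_sum, ← Finset.sum_neg_distrib]
    exact Finset.sum_congr rfl fun i _ => by ring
  rw [hflux]
  -- `|y|² = Σᵢ yᵢ²` and discrete Cauchy–Schwarz
  have hy2 : ‖y‖ ^ 2 = ∑ i, y i ^ 2 := by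
    rw [EuclideanSpace.norm_eq, Real.sq_sqrt (Finset.sum_nonneg fun i _ => sq_nonneg _)]
    exact Finset.sum_congr rfl fun i _ => by rw [Real.norm_eq_abs, sq_abs]
  have hCS : (∑ i, y i * fderiv ℝ (w s) y (EuclideanSpace.single i 1)) ^ 2 ≤
      ‖y‖ ^ 2 * ∑ i, fderiv ℝ (w s) y (EuclideanSpace.single i 1) ^ 2 := by
    rw [hy2]
    exact Finset.sum_mul_sq_le_sq_mul_sq _ _ _
  have h := flux_dominated_aux (u := deriv (fun s'' => w s'' y) s) hγ0 hγc hc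
    (Finset.sum_nonneg fun i _ => sq_nonneg _) hCS (norm_nonneg y) (norm_le_bracket y)
  linarith

/-- **Source control.**  If `|γ'(w) ∂ₛw| ≤ K γ(w)` at `(s, y)` then `σ ≤ K e` there:
`½γ'(w)∂ₛw|∇w|² ≤ ½Kγ|∇w|² ≤ K(½(∂ₛw)² + ½γ|∇w|²)`. [folklore] -/
theorem waveEnergy_source_le {K : ℝ} (s : ℝ) (y : EuclideanSpace ℝ (Fin n)) (hK : 0 ≤ K)
    (hγK : |deriv γ (w s y) * deriv (fun s'' => w s'' y) s| ≤ K * γ (w s y)) :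
    (1 / 2) * deriv γ (w s y) * deriv (fun s'' => w s'' y) s *
        ∑ i, fderiv ℝ (w s) y (EuclideanSpace.single i 1) ^ 2 ≤
      K * ((1 / 2) * deriv (fun s'' => w s'' y) s ^ 2 +
        (1 / 2) * γ (w s y) * ∑ i, fderiv ℝ (w s) y (EuclideanSpace.single i 1) ^ 2) := by
  set A : ℝ := ∑ i, fderiv ℝ (w s) y (EuclideanSpace.single i 1) ^ 2 with hA
  have hA0 : 0 ≤ A := Finset.sum_nonneg fun i _ => sq_nonneg _
  have h1 : (1 / 2) * deriv γ (w s y) * deriv (fun s'' => w s'' y) s * A ≤ (1 / 2) * (K * γ (w s y)) * A := by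
    have := mul_le_mul_of_nonneg_right ((le_abs_self _).trans hγK) hA0
    nlinarith
  have h2 : 0 ≤ K * ((1 / 2) * deriv (fun s'' => w s'' y) s ^ 2) := by positivity
  nlinarith

/-! ### The local energy inequality for the equation -/

/-- **Local energy inequality / domain of dependence for `w_ss = div(γ(w)∇w)` (ball form).**  Let `w : ℝ × ℝⁿ → ℝ` be jointly smooth and
solve `∂ₛ∂ₛw = Σᵢ ∂ᵢ(γ(w)∂ᵢw)` with `γ` smooth; on the heights `s ≥ t₀` assume `0 ≤ γ(w) ≤ c²` and `|γ'(w)∂ₛw| ≤ Kγ(w)` (`c, K ≥ 0`).  Then for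
`t ≥ t₀` and every radius `ρ`, with `e = ½(∂ₛw)² + ½γ(w)|∇w|²`:
`∫_{|y| ≤ ρ} e(t, y) dy ≤ exp(K(t − t₀)) ∫_{|y| ≤ √(1+ρ²) + c(t−t₀) + 1} e(t₀, y) dy`. [folklore] -/
theorem waveEnergy_closedBall_le_exp_mul (hw : ContDiff ℝ ∞ (uncurry w)) (hγ : ContDiff ℝ ∞ γ)
    (hpde : ∀ s y, deriv (fun s' => deriv (fun s'' => w s'' y) s') s =
      ∑ i, fderiv ℝ (fun y' => γ (w s y') * fderiv ℝ (w s) y' (EuclideanSpace.single i 1)) y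
        (EuclideanSpace.single i 1))
    {c K t₀ : ℝ} (hc : 0 ≤ c) (hK : 0 ≤ K)
    (hγ0 : ∀ s, t₀ ≤ s → ∀ y : EuclideanSpace ℝ (Fin n), 0 ≤ γ (w s y))
    (hγc : ∀ s, t₀ ≤ s → ∀ y : EuclideanSpace ℝ (Fin n), γ (w s y) ≤ c ^ 2)
    (hγK : ∀ s, t₀ ≤ s → ∀ y : EuclideanSpace ℝ (Fin n),
      |deriv γ (w s y) * deriv (fun s'' => w s'' y) s| ≤ K * γ (w s y))
    {t : ℝ} (ht : t₀ ≤ t) (ρ : ℝ) :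
    ∫ y in closedBall (0 : EuclideanSpace ℝ (Fin n)) ρ,
        ((1 / 2) * deriv (fun s'' => w s'' y) t ^ 2 +
          (1 / 2) * γ (w t y) * ∑ i, fderiv ℝ (w t) y (EuclideanSpace.single i 1) ^ 2) ≤
      Real.exp (K * (t - t₀)) *
        ∫ y in closedBall (0 : EuclideanSpace ℝ (Fin n)) (√(1 + ρ ^ 2) + c * (t - t₀) + 1),
          ((1 / 2) * deriv (fun s'' => w s'' y) t₀ ^ 2 +
            (1 / 2) * γ (w t₀ y) * ∑ i, fderiv ℝ (w t₀) y (EuclideanSpace.single i 1) ^ 2) := by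
  refine setIntegral_closedBall_le_exp_mul
    (e := fun s y => (1 / 2) * deriv (fun s'' => w s'' y) s ^ 2 +
      (1 / 2) * γ (w s y) * ∑ i, fderiv ℝ (w s) y (EuclideanSpace.single i 1) ^ 2)
    (f := fun i s y => -(γ (w s y) * deriv (fun s'' => w s'' y) s * fderiv ℝ (w s) y (EuclideanSpace.single i 1)))
    (σ := fun s y => (1 / 2) * deriv γ (w s y) * deriv (fun s'' => w s'' y) s *
      ∑ i, fderiv ℝ (w s) y (EuclideanSpace.single i 1) ^ 2)
    (contDiff_uncurry_energy hw hγ) (contDiff_uncurry_flux hw hγ) (contDiff_uncurry_source hw hγ)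
    (fun s y => waveEnergy_balance hw hγ hpde s y) ?_ ?_ ?_ ht ρ
  · intro s hs y
    have hA0 : 0 ≤ ∑ i, fderiv ℝ (w s) y (EuclideanSpace.single i 1) ^ 2 := Finset.sum_nonneg fun i _ => sq_nonneg _
    nlinarith [sq_nonneg (deriv (fun s'' => w s'' y) s), mul_nonneg (hγ0 s hs y) hA0]
  · intro s hs y
    exact waveEnergy_flux_dominated hc s y (hγ0 s hs y) (hγc s hs y)
  · intro s hs y
    exact waveEnergy_source_le s y hK (hγK s hs y)

/-! ### Domain of dependence proper: static data stay static inside the cone -/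

/-- A continuous nonnegative function with vanishing integral over a closed ball vanishes on the open ball (the open support meets the
ball in an open set, which has positive Lebesgue measure unless empty). [folklore] -/
theorem eq_zero_of_setIntegral_closedBall_eq_zero {g : EuclideanSpace ℝ (Fin n) → ℝ} (hg : Continuous g)
    (hg0 : ∀ y, 0 ≤ g y) {ρ : ℝ} (hint : ∫ y in closedBall (0 : EuclideanSpace ℝ (Fin n)) ρ, g y = 0)
    {y : EuclideanSpace ℝ (Fin n)} (hy : y ∈ ball (0 : EuclideanSpace ℝ (Fin n)) ρ) : g y = 0 := by
  by_contra hne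
  have hI : IntegrableOn g (closedBall (0 : EuclideanSpace ℝ (Fin n)) ρ) :=
    hg.continuousOn.integrableOn_compact (isCompact_closedBall _ _)
  have hopen : IsOpen (Function.support g ∩ ball (0 : EuclideanSpace ℝ (Fin n)) ρ) :=
    (isOpen_ne_fun hg continuous_const).inter isOpen_ball
  have hmem : y ∈ Function.support g ∩ ball (0 : EuclideanSpace ℝ (Fin n)) ρ := ⟨hne, hy⟩
  have hpos : 0 < volume (Function.support g ∩ ball (0 : EuclideanSpace ℝ (Fin n)) ρ) :=
    hopen.measure_pos volume ⟨y, hmem⟩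
  have hpos' : 0 < volume (Function.support g ∩ closedBall (0 : EuclideanSpace ℝ (Fin n)) ρ) :=
    hpos.trans_le (measure_mono (inter_subset_inter_right _ ball_subset_closedBall))
  have hint' : 0 < ∫ y in closedBall (0 : EuclideanSpace ℝ (Fin n)) ρ, g y :=
    (setIntegral_pos_iff_support_of_nonneg_ae (Eventually.of_forall hg0) hI).2 hpos'
  linarith

/-- **Domain of dependence for `w_ss = div(γ(w)∇w)`.**  Under the hypotheses of `waveEnergy_closedBall_le_exp_mul`, if the data at height `t₀`
are STATIC on the ball `|y| ≤ √(1+ρ²) + c(t − t₀) + 1` (`∂ₛw(t₀,·) = 0` and `∇w(t₀,·) = 0` there), then at every height `t ≥ t₀` the solution is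
static on the open ball `|y| < ρ`: `∂ₛw(t, y) = 0` and `γ(w)·|∇w|²(t, y) = 0`. [folklore] -/
theorem static_of_static_data (hw : ContDiff ℝ ∞ (uncurry w)) (hγ : ContDiff ℝ ∞ γ)
    (hpde : ∀ s y, deriv (fun s' => deriv (fun s'' => w s'' y) s') s =
      ∑ i, fderiv ℝ (fun y' => γ (w s y') * fderiv ℝ (w s) y' (EuclideanSpace.single i 1)) y
        (EuclideanSpace.single i 1))
    {c K t₀ : ℝ} (hc : 0 ≤ c) (hK : 0 ≤ K)
    (hγ0 : ∀ s, t₀ ≤ s → ∀ y : EuclideanSpace ℝ (Fin n), 0 ≤ γ (w s y))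
    (hγc : ∀ s, t₀ ≤ s → ∀ y : EuclideanSpace ℝ (Fin n), γ (w s y) ≤ c ^ 2)
    (hγK : ∀ s, t₀ ≤ s → ∀ y : EuclideanSpace ℝ (Fin n),
      |deriv γ (w s y) * deriv (fun s'' => w s'' y) s| ≤ K * γ (w s y))
    {t : ℝ} (ht : t₀ ≤ t) {ρ : ℝ}
    (hstatic : ∀ y ∈ closedBall (0 : EuclideanSpace ℝ (Fin n)) (√(1 + ρ ^ 2) + c * (t - t₀) + 1),
      deriv (fun s'' => w s'' y) t₀ = 0 ∧ ∀ i, fderiv ℝ (w t₀) y (EuclideanSpace.single i 1) = 0)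
    {y : EuclideanSpace ℝ (Fin n)} (hy : y ∈ ball (0 : EuclideanSpace ℝ (Fin n)) ρ) :
    deriv (fun s'' => w s'' y) t = 0 ∧
      γ (w t y) * ∑ i, fderiv ℝ (w t) y (EuclideanSpace.single i 1) ^ 2 = 0 := by
  have hle := waveEnergy_closedBall_le_exp_mul hw hγ hpde hc hK hγ0 hγc hγK ht ρ
  -- the data energy vanishes on the big ball
  have hdata : ∫ y in closedBall (0 : EuclideanSpace ℝ (Fin n)) (√(1 + ρ ^ 2) + c * (t - t₀) + 1),
      ((1 / 2) * deriv (fun s'' => w s'' y) t₀ ^ 2 +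
        (1 / 2) * γ (w t₀ y) * ∑ i, fderiv ℝ (w t₀) y (EuclideanSpace.single i 1) ^ 2) = 0 := by
    refine setIntegral_eq_zero_of_forall_eq_zero fun y hy' => ?_
    obtain ⟨h1, h2⟩ := hstatic y hy'
    simp [h1, h2]
  rw [hdata, mul_zero] at hle
  -- the energy at height `t` is continuous and nonnegative, so it vanishes on the open ball
  have hcont : Continuous fun y : EuclideanSpace ℝ (Fin n) => (1 / 2) * deriv (fun s'' => w s'' y) t ^ 2 +
      (1 / 2) * γ (w t y) * ∑ i, fderiv ℝ (w t) y (EuclideanSpace.single i 1) ^ 2 :=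
    (contDiff_slice (contDiff_uncurry_energy hw hγ) t).continuous
  have hnn : ∀ y : EuclideanSpace ℝ (Fin n), 0 ≤ (1 / 2) * deriv (fun s'' => w s'' y) t ^ 2 +
      (1 / 2) * γ (w t y) * ∑ i, fderiv ℝ (w t) y (EuclideanSpace.single i 1) ^ 2 := by
    intro y
    have hA0 : 0 ≤ ∑ i, fderiv ℝ (w t) y (EuclideanSpace.single i 1) ^ 2 := Finset.sum_nonneg fun i _ => sq_nonneg _
    nlinarith [sq_nonneg (deriv (fun s'' => w s'' y) t), mul_nonneg (hγ0 t ht y) hA0]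
  have hint0 : ∫ y in closedBall (0 : EuclideanSpace ℝ (Fin n)) ρ,
      ((1 / 2) * deriv (fun s'' => w s'' y) t ^ 2 +
        (1 / 2) * γ (w t y) * ∑ i, fderiv ℝ (w t) y (EuclideanSpace.single i 1) ^ 2) = 0 :=
    le_antisymm hle (setIntegral_nonneg measurableSet_closedBall fun y _ => hnn y)
  have hzero := eq_zero_of_setIntegral_closedBall_eq_zero hcont hnn hint0 hy
  have hA0 : 0 ≤ ∑ i, fderiv ℝ (w t) y (EuclideanSpace.single i 1) ^ 2 := Finset.sum_nonneg fun i _ => sq_nonneg _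
  have h1 : 0 ≤ (1 / 2) * deriv (fun s'' => w s'' y) t ^ 2 := by positivity
  have h2 : 0 ≤ (1 / 2) * γ (w t y) * ∑ i, fderiv ℝ (w t) y (EuclideanSpace.single i 1) ^ 2 :=
    mul_nonneg (mul_nonneg (by norm_num) (hγ0 t ht y)) hA0
  constructor
  · nlinarith [sq_nonneg (deriv (fun s'' => w s'' y) t)]
  · nlinarith

end Summit.NavierStokesRegularity.NavierStokesRegularity.Theorems.PoloidalWindowDoorPoloidalWindowRigidityZShockWaveLocalEnergy

end
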